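import Literature.NumberTheory.Automorphic.HyperspecialUnitarySatakeIsomorphism
import Literature.NumberTheory.Automorphic.SplitOrthogonalBorelModulusIndex
import HarnessLib

/-!
# Weyl-group invariance of the Satake transform of the split orthogonal group `O_N(J₀) = U(id, J₀)` in every rank
# (Satake 1963 §§6, 8–9; Cartier 1979 §IV Thm. 4.1 (b))

Topic `NumberTheory/Automorphic`; namespace `Literature.NumberTheory.Automorphic.HermitianLattice[.UnramifiedLocalConjDatum]`
(lane `lit-hodgefound`, Track 2 foundations; seat `lit-hodgefound-p11`, generation 49, row g49-#2).  THEOREMS ONLY: no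
definition, no named fact, no instance, no notation.  The `σ = id` companion of `HyperspecialUnitarySatakeWeylInvariance`
(g48-#5, `σ ≠ id`).

## The mathematics

`K` a field with a discrete valuation, finite residue field of `q` elements and an unramified datum for `σ = id`
(`UnramifiedLocalConjDatum (RingHom.id K) ϖ`: non-dyadic, `1`-units are squares — `SplitOrthogonalUnramifiedDatum`), so that
`G = U(id, J₀^{(N)}) = O_N(J₀) = {g : gᵀ J₀ g = J₀}` is the SPLIT ORTHOGONAL GROUP (Witt index `m = ⌊N/2⌋`), `K₀ = G ∩ GL_N(𝒪)`
hyperspecial.  The cocharacters of the diagonal torus are the antisymmetric `μ ∈ ℤ^N` (`μ ∘ rev = -μ`), and the group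
`W = C_{S_N}(rev) ≅ (ℤ/2)^m ⋊ S_m` of coordinate permutations commuting with `rev` — the Weyl group of `B_m` (`N = 2m+1`), and for
`N = 2m` the Weyl group `W(D_m)` extended by the outer sign change realised inside the disconnected group `O_{2m}` (its element
`(m-1, m) ∈ K₀`) — acts on them.  THEOREM (Satake 1963 §§8–9; Cartier Thm. 4.1 (b)): for every commutative ring `R`, every unit
`u ∈ Rˣ` with `u² = q`, and the ORTHOGONAL weight `w(e) = u^{-Λ(e)}`, `Λ(e) = ∑_{i<j, i<j'} (e_i - e_j)` (`= ⟨2ρ, e⟩`, the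
`δ_B^{1/2}`-normalisation of `O_N`, `SplitOrthogonalBorelModulusIndex`), the Satake transform `𝒮_w(T) ∈ R[ℤ^N]` of every
`T ∈ ℋ_R(O_N(J₀), K₀)` is `W`-invariant: **`𝒮_w(T)_{μ ∘ π} = 𝒮_w(T)_μ` for every `π` commuting with `rev`.**

PROOF.  The Levi descents of g48 (`HyperspecialUnitaryParabolicBlocks`, `…SatakeSiegelDescent`, `…SatakeKlingenDescent`) are
stated for an ARBITRARY `σ`; only the weight bookkeeping changes.  On the antisymmetric lattice `Λ(μ) = ⟨ν, μ⟩ - ∑_{i<N/2} μ_i`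
(`⟨ν, ·⟩ = satakeTwistExp`), so on transforms (which vanish off the antisymmetric lattice) the orthogonal weight may be
replaced by `w'(e) = u^{-(⟨ν,e⟩ - hs(e))}`, `hs(e) = ∑_{i<N/2} e_i` (§2).  Induction on `N`, step `2`, as in g48-#5: (i) a
`rev`-commuting `ρ` fixing `0` is a Klingen extension `π̂'`, and `w' ∘ κ₀ = u^{-|·|} · w'_M` (`⟨ν_{M+2}, κ₀λ⟩ = ⟨ν_M, λ⟩ + |λ|`,
`hs_{M+2}(κ₀λ) = hs_M(λ)`), `|λ ∘ π'| = |λ|`, so the Klingen descent reduces to the induction hypothesis for `O_M(J₀)`;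
(ii) for `ρ(0)` in the first block, `t = (0 k)(M+1, rev k)` preserves the first block and the SIEGEL descent (which needs
`u² = #𝓀 = q`) gives the `t`-invariance of `𝒮_{u^{-⟨ν,·⟩}}(T)`, transported to `w'` because `hs` is invariant under
block-preserving permutations; (iii) otherwise compose with `rev`, under which `𝒮_w(T)` is invariant by the `w₀`-symmetry of
g47-#5 (`coeff_satakeTransform_neg_of_units_orthogonal`) and the support condition.

## What is formalised (theorems only)

* §1 bookkeeping: `lt_rev_iff_lt_div_two`, `sum_filter_lt_rev_eq_headSum`, `headSum_add`, `headSum_comp_perm_of_iff`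
  (block-preserving `π`), **`orthogonalExp_eq_satakeTwistExp_sub_headSum`** (`Λ = ⟨ν,·⟩ - hs` on the antisymmetric lattice),
  **`headSum_klingenMidHom`** (`hs_{M+2}(κ₀λ) = hs_M(λ)`), weights `exists_weight_units_zpow_neg_satakeTwistExp_sub_headSum`,
  `exists_weight_units_zpow_neg_klingen_orthogonal`, `comp_klingenMidHom_eq_orthogonal`.
* §2 (any `σ`) **`coeff_satakeTransform_eq_of_forall_rev_weight_eq`** (weights agreeing on the antisymmetric lattice give the
  same coefficients), `satakeTransform_eq_of_forall_rev_weight_eq`, `coeff_satakeTransform_comp_eq_of_weight_mul` (transport of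
  an invariance along `w = c · w₀` with `c` invariant); (`σ = id`) `coeff_satakeTransform_comp_rev_of_units_orthogonal`.
* §3 **`coeff_satakeTransform_comp_perm_of_units_orthogonal'`** (weight `u^{-(⟨ν,·⟩ - hs)}`) and
  **`coeff_satakeTransform_comp_perm_of_units_orthogonal`** (THE THEOREM, orthogonal weight `u^{-Λ}`),
  `domCongr_funCongrLeft_satakeTransform_of_units_orthogonal` (`π^*(𝒮_w T) = 𝒮_w T`).
* §4 **`isIwasawaExponent_satakeTransform_mem_unitarySatakeTarget_orthogonal`** (`𝒮_w(T) ∈ R[Λ⁻]^W` for `O_N(J₀)`).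

## References
* [Satake1963] I. Satake, *Theory of spherical functions on reductive algebraic groups over 𝔭-adic fields*, Publ. Math. IHÉS 18
  (1963), §6 (Thm. 7), §§8–9 (the classical groups, orthogonal case).
* [CartierCorvallis1979] P. Cartier, *Representations of 𝔭-adic groups: a survey*, PSPM 33.1 (1979), §IV (4.2), Thm. 4.1 and its
  proof (b).
* [BruhatTits1972] F. Bruhat, J. Tits, *Groupes réductifs sur un corps local I*, Publ. Math. IHÉS 41 (1972), (4.4.3).
* [Tits1979] J. Tits, *Reductive groups over local fields*, PSPM 33.1 (1979), §3.3.3.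
* [Macdonald1971] I. G. Macdonald, *Spherical functions on a group of p-adic type*, Madras (1971), Ch. IV–V.
-/

noncomputable section

open scoped Valued WithZero Matrix MatrixGroups
open MonoidAlgebra Representation

namespace Literature.NumberTheory.Automorphic.HermitianLattice

open Literature.NumberTheory.Automorphic Literature.NumberTheory.Automorphic.CartanUnique

variable {K : Type*} [Field K] [Valued K ℤᵐ⁰] {σ : K →+* K} {ϖ : K} {M N : ℕ} {R : Type*} [CommRing R]

/-! ## §1 Exponent bookkeeping: `Λ = ⟨ν, ·⟩ - hs` on the antisymmetric lattice, `hs` through `κ₀` and under block-preserving `π` -/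

section Bookkeeping

/-- `i < rev i` iff `i` lies in the first block `[0, N/2)`. [cite: BruhatTits1972, (4.4.3)] -/
theorem lt_rev_iff_lt_div_two (i : Fin N) : i < Fin.rev i ↔ (i : ℕ) < N / 2 := by
  rw [Fin.lt_def, Fin.val_rev]
  have := i.isLt
  omega

/-- `∑_{i < i'} μ_i = hs(μ) = ∑_{i < N/2} μ_i` (`headSum μ (N/2)`). [cite: BruhatTits1972, (4.4.3)] -/
theorem sum_filter_lt_rev_eq_headSum (μ : Fin N → ℤ) :
    ∑ i ∈ (Finset.univ : Finset (Fin N)) with i < Fin.rev i, μ i = headSum μ (N / 2) := by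
  rw [headSum, Finset.sum_filter]
  refine Finset.sum_congr rfl fun i _ => ?_
  by_cases h : (i : ℕ) < N / 2
  · rw [if_pos ((lt_rev_iff_lt_div_two i).2 h), if_pos h]
  · rw [if_neg (fun h' => h ((lt_rev_iff_lt_div_two i).1 h')), if_neg h]

/-- Head sums are additive. [cite: BruhatTits1972, (4.4.4)] -/
theorem headSum_add (μ ν : Fin N → ℤ) (r : ℕ) : headSum (μ + ν) r = headSum μ r + headSum ν r := by
  rw [headSum, headSum, headSum, ← Finset.sum_add_distrib]
  exact Finset.sum_congr rfl fun i _ => by split_ifs <;> simp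

/-- `hs(μ ∘ π) = hs(μ)` for a permutation `π` preserving the first block. [cite: BruhatTits1972, (4.4.3)] -/
theorem headSum_comp_perm_of_iff (μ : Fin N → ℤ) {π : Equiv.Perm (Fin N)}
    (hπ : ∀ i : Fin N, ((π i : ℕ) < N / 2 ↔ (i : ℕ) < N / 2)) : headSum (μ ∘ π) (N / 2) = headSum μ (N / 2) := by
  rw [headSum, headSum]
  calc (∑ i : Fin N, if (i : ℕ) < N / 2 then (μ ∘ π) i else 0)
      = ∑ i : Fin N, (fun j : Fin N => if (j : ℕ) < N / 2 then μ j else 0) (π i) :=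
        Finset.sum_congr rfl fun i _ => by simp only [Function.comp_apply, hπ i]
    _ = ∑ j : Fin N, if (j : ℕ) < N / 2 then μ j else 0 :=
        Equiv.sum_comp π (fun j : Fin N => if (j : ℕ) < N / 2 then μ j else 0)

/-- **`Λ(μ) = ⟨ν, μ⟩ - hs(μ)` on the antisymmetric lattice**: `∑_{i<j, i<j'} (μ_i - μ_j) = satakeTwistExp μ - ∑_{i<N/2} μ_i` for
`μ ∘ rev = -μ` (`2Λ + 2∑_{i<i'} μ_i = ∑_{i<j} (μ_i - μ_j) = 2⟨ν, μ⟩`). [cite: CartierCorvallis1979, §IV (4.2)]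
[cite: Satake1963, §§8–9] -/
theorem orthogonalExp_eq_satakeTwistExp_sub_headSum {μ : Fin N → ℤ} (hμ : ∀ i, μ (Fin.rev i) = -μ i) :
    ∑ p ∈ (Finset.univ : Finset (Fin N × Fin N)) with (p.1 < p.2 ∧ p.1 < Fin.rev p.2), (μ p.1 - μ p.2) =
      satakeTwistExp μ - headSum μ (N / 2) := by
  have h1 := two_mul_sum_add_sum_eq hμ
  rw [sum_filter_eq_rev_sub_eq_two_mul hμ, sum_filter_lt_sub_eq_two_mul_satakeTwistExp μ hμ, sum_filter_lt_rev_eq_headSum] at h1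
  omega

/-- `hs_{M+2}(κ(0, λ)) = hs_M(λ)`, in the block typing `Fin (M + 2 - 2·1)` of `HyperspecialUnitaryParabolicBlocks`.
[cite: BruhatTits1972, (4.4.3)] -/
theorem headSum_klingenExp_zero (la : Fin (M + 2 - 2 * 1) → ℤ) :
    headSum (klingenExp M 0 la) ((M + 2) / 2) = headSum la ((M + 2 - 2 * 1) / 2) := by
  rw [headSum, headSum, sum_eq_sum_blocks (two_mul_one_le_add_two (M := M))]
  simp only [castLE_fin_one, klingenExp_zero, hiIndex_fin_one, klingenExp_last, neg_zero, ite_self, Finset.sum_const_zero,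
    zero_add, add_zero, klingenExp_midIndex, coe_midIndex]
  refine Finset.sum_congr rfl fun j _ => ?_
  have hj := j.isLt
  by_cases h : (j : ℕ) < (M + 2 - 2 * 1) / 2
  · rw [if_pos h, if_pos (by omega)]
  · rw [if_neg h, if_neg (by omega)]

/-- **`hs_{M+2}(κ₀ λ) = hs_M(λ)`** for `λ ∈ ℤ^M` (`κ₀ λ = (0, λ, 0)`). [cite: BruhatTits1972, (4.4.3)] -/
theorem headSum_klingenMidHom (la : Fin M → ℤ) : headSum (klingenMidHom M la) ((M + 2) / 2) = headSum la (M / 2) :=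
  headSum_klingenExp_zero la

/-- The weight `e ↦ u^{-(⟨ν, e⟩ - hs(e))}` exists as a character of `ℤ^N`; on the antisymmetric lattice it is the orthogonal
weight `u^{-Λ}`. [cite: CartierCorvallis1979, §IV (4.2)] -/
theorem exists_weight_units_zpow_neg_satakeTwistExp_sub_headSum (u : Rˣ) :
    ∃ w : Multiplicative (Fin N → ℤ) →* R,
      ∀ e : Fin N → ℤ, w (Multiplicative.ofAdd e) = ((u ^ (-(satakeTwistExp e - headSum e (N / 2))) : Rˣ) : R) := by
  obtain ⟨w, hw⟩ := exists_monoidHom_apply_ofAdd_eq_units_zpow (Λ := Fin N → ℤ) u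
    (-(AddMonoidHom.mk' (fun e : Fin N → ℤ => satakeTwistExp e - headSum e (N / 2)) fun a b => by
      rw [satakeTwistExp_add, headSum_add]; ring))
  exact ⟨w, fun e => by rw [hw]; rfl⟩

/-- The Klingen weight `λ ↦ u^{-(⟨ν_M, λ⟩ + |λ| - hs_M(λ))}` (`= w' ∘ κ₀`) exists as a character of `ℤ^M`.
[cite: CartierCorvallis1979, §IV (4.2)] -/
theorem exists_weight_units_zpow_neg_klingen_orthogonal (u : Rˣ) :
    ∃ w'' : Multiplicative (Fin M → ℤ) →* R,
      ∀ e : Fin M → ℤ, w'' (Multiplicative.ofAdd e) = ((u ^ (-(satakeTwistExp e + ∑ j, e j - headSum e (M / 2))) : Rˣ) : R) := by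
  obtain ⟨w, hw⟩ := exists_monoidHom_apply_ofAdd_eq_units_zpow (Λ := Fin M → ℤ) u
    (-(AddMonoidHom.mk' (fun e : Fin M → ℤ => satakeTwistExp e + ∑ j, e j - headSum e (M / 2)) fun a b => by
      simp only [satakeTwistExp_add, headSum_add, Pi.add_apply, Finset.sum_add_distrib]; ring))
  exact ⟨w, fun e => by rw [hw]; rfl⟩

/-- **`w' ∘ κ₀ = u^{-(⟨ν_M, ·⟩ + |·| - hs_M)}`** for `w' = u^{-(⟨ν_{M+2}, ·⟩ - hs_{M+2})}`, as characters of `ℤ^M`.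
[cite: CartierCorvallis1979, §IV (4.2)] -/
theorem comp_klingenMidHom_eq_orthogonal {u : Rˣ} {w : Multiplicative (Fin (M + 2) → ℤ) →* R}
    (hw : ∀ e : Fin (M + 2) → ℤ, w (Multiplicative.ofAdd e) = ((u ^ (-(satakeTwistExp e - headSum e ((M + 2) / 2))) : Rˣ) : R))
    {w'' : Multiplicative (Fin M → ℤ) →* R}
    (hw'' : ∀ e : Fin M → ℤ, w'' (Multiplicative.ofAdd e) = ((u ^ (-(satakeTwistExp e + ∑ j, e j - headSum e (M / 2))) : Rˣ) : R)) :
    (w.comp (AddMonoidHom.toMultiplicative (klingenMidHom M)) : Multiplicative (Fin M → ℤ) →* R) = w'' := by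
  refine MonoidHom.ext fun x => ?_
  show w (Multiplicative.ofAdd (klingenMidHom M (Multiplicative.toAdd x : Fin M → ℤ))) =
    w'' (Multiplicative.ofAdd (Multiplicative.toAdd x))
  rw [hw, satakeTwistExp_klingenMidHom, headSum_klingenMidHom, hw'']

end Bookkeeping

/-! ## §2 Transport between weights; `rev`-invariance for `O_N(J₀)` -/

section Transport

namespace UnramifiedLocalConjDatum

/-- **Weights agreeing on the antisymmetric lattice give the same coefficients** (any `σ`): the transforms vanish off the
antisymmetric lattice (`coeff_satakeTransform_eq_zero_of_not_rev`). [cite: CartierCorvallis1979, §IV (4.2)] [cite: BruhatTits1972, (4.4.3)] -/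
theorem coeff_satakeTransform_eq_of_forall_rev_weight_eq (hd : UnramifiedLocalConjDatum σ ϖ) [Finite 𝓀[K]]
    (w w' : Multiplicative (Fin N → ℤ) →* R)
    (h : ∀ e : Fin N → ℤ, (∀ i, e (Fin.rev i) = -e i) → w (Multiplicative.ofAdd e) = w' (Multiplicative.ofAdd e))
    (T : heckeAlgebra R (unitaryGroupOfForm σ ((StdForm.antidiagonal N).over K)) (unitaryInt σ ((StdForm.antidiagonal N).over K)))
    (μ : Fin N → ℤ) :
    ((hd.isIwasawaExponent (N := N)).satakeTransform w T).coeff μ = ((hd.isIwasawaExponent (N := N)).satakeTransform w' T).coeff μ := by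
  by_cases hμ : ∀ i, μ (Fin.rev i) = -μ i
  · rw [hd.coeff_satakeTransform_eq_weight_mul w T μ, hd.coeff_satakeTransform_eq_weight_mul w' T μ, h μ hμ]
  · rw [hd.coeff_satakeTransform_eq_zero_of_not_rev w T hμ, hd.coeff_satakeTransform_eq_zero_of_not_rev w' T hμ]

/-- Weights agreeing on the antisymmetric lattice give the same transform (any `σ`). [cite: CartierCorvallis1979, §IV (4.2)] -/
theorem satakeTransform_eq_of_forall_rev_weight_eq (hd : UnramifiedLocalConjDatum σ ϖ) [Finite 𝓀[K]]
    (w w' : Multiplicative (Fin N → ℤ) →* R)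
    (h : ∀ e : Fin N → ℤ, (∀ i, e (Fin.rev i) = -e i) → w (Multiplicative.ofAdd e) = w' (Multiplicative.ofAdd e))
    (T : heckeAlgebra R (unitaryGroupOfForm σ ((StdForm.antidiagonal N).over K)) (unitaryInt σ ((StdForm.antidiagonal N).over K))) :
    (hd.isIwasawaExponent (N := N)).satakeTransform w T = (hd.isIwasawaExponent (N := N)).satakeTransform w' T :=
  AddMonoidAlgebra.ext (Finsupp.ext fun μ => hd.coeff_satakeTransform_eq_of_forall_rev_weight_eq w w' h T μ)

/-- **Transport of an invariance along `w = c · w₀`** (any `σ`): if `w(e) = c(e) w₀(e)`, `c(ν ∘ ρ) = c(ν)` and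
`𝒮_{w₀}(T)_{ν ∘ ρ} = 𝒮_{w₀}(T)_ν`, then `𝒮_w(T)_{ν ∘ ρ} = 𝒮_w(T)_ν`. [cite: CartierCorvallis1979, §IV (4.2)] -/
theorem coeff_satakeTransform_comp_eq_of_weight_mul (hd : UnramifiedLocalConjDatum σ ϖ) [Finite 𝓀[K]]
    (w w₀ : Multiplicative (Fin N → ℤ) →* R) (c : (Fin N → ℤ) → R)
    (hc : ∀ e : Fin N → ℤ, w (Multiplicative.ofAdd e) = c e * w₀ (Multiplicative.ofAdd e))
    (T : heckeAlgebra R (unitaryGroupOfForm σ ((StdForm.antidiagonal N).over K)) (unitaryInt σ ((StdForm.antidiagonal N).over K)))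
    {ρ : Equiv.Perm (Fin N)} {ν : Fin N → ℤ} (hρ : c (ν ∘ ρ) = c ν)
    (h₀ : ((hd.isIwasawaExponent (N := N)).satakeTransform w₀ T).coeff (ν ∘ ρ) = ((hd.isIwasawaExponent (N := N)).satakeTransform w₀ T).coeff ν) :
    ((hd.isIwasawaExponent (N := N)).satakeTransform w T).coeff (ν ∘ ρ) = ((hd.isIwasawaExponent (N := N)).satakeTransform w T).coeff ν := by
  rw [hd.coeff_satakeTransform_eq_weight_mul w T, hd.coeff_satakeTransform_eq_weight_mul w T ν, hc, hc, hρ, mul_assoc, mul_assoc,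
    ← hd.coeff_satakeTransform_eq_weight_mul w₀ T, ← hd.coeff_satakeTransform_eq_weight_mul w₀ T ν, h₀]

/-- **`rev`-invariance for `O_N(J₀)` in every rank**: `𝒮_w(T)_{μ ∘ rev} = 𝒮_w(T)_μ` for the orthogonal weight `w(e) = u^{-Λ(e)}`,
`u² = q`, from the `w₀ = -1` symmetry `𝒮_w(T)_{-μ} = 𝒮_w(T)_μ` (g47-#5) and the support condition `μ ∘ rev = -μ`.
[cite: Satake1963, §§8–9] [cite: CartierCorvallis1979, §IV Thm. 4.1] -/
theorem coeff_satakeTransform_comp_rev_of_units_orthogonal (hd : UnramifiedLocalConjDatum (RingHom.id K) ϖ) [Finite 𝓀[K]]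
    (u : Rˣ) (hu : (u : R) ^ 2 = Nat.card 𝓀[K]) (w : Multiplicative (Fin N → ℤ) →* R)
    (hw : ∀ e : Fin N → ℤ, w (Multiplicative.ofAdd e) =
      ((u ^ (-∑ p ∈ (Finset.univ : Finset (Fin N × Fin N)) with (p.1 < p.2 ∧ p.1 < Fin.rev p.2), (e p.1 - e p.2)) : Rˣ) : R))
    (T : heckeAlgebra R (unitaryGroupOfForm (RingHom.id K) ((StdForm.antidiagonal N).over K))
      (unitaryInt (RingHom.id K) ((StdForm.antidiagonal N).over K)))
    (μ : Fin N → ℤ) :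
    ((hd.isIwasawaExponent (N := N)).satakeTransform w T).coeff (μ ∘ Fin.rev) =
      ((hd.isIwasawaExponent (N := N)).satakeTransform w T).coeff μ := by
  haveI := isHeckeTriple_unitaryInt_of_finite_residueField hd.vϖ (RingHom.id K) ((StdForm.antidiagonal N).over K)
  by_cases hμ : ∀ i, μ (Fin.rev i) = -μ i
  · rw [show μ ∘ Fin.rev = -μ from funext fun i => hμ i]
    exact hd.coeff_satakeTransform_neg_of_units_orthogonal u hu w hw T μ
  · have hμ' : ¬ ∀ i, (μ ∘ Fin.rev) (Fin.rev i) = -(μ ∘ Fin.rev) i := fun h => hμ fun i => by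
      have := h (Fin.rev i); simp only [Function.comp_apply, Fin.rev_rev] at this; omega
    rw [hd.coeff_satakeTransform_eq_zero_of_not_rev w T hμ, hd.coeff_satakeTransform_eq_zero_of_not_rev w T hμ']

end UnramifiedLocalConjDatum

end Transport

/-! ## §3 The theorem -/

section Main

namespace UnramifiedLocalConjDatum

/-- **Weyl invariance for the weight `w'(e) = u^{-(⟨ν,e⟩ - hs(e))}`** (`u² = q`; on the antisymmetric lattice `w' = u^{-Λ}`):
`𝒮_{w'}(T)_{μ ∘ π} = 𝒮_{w'}(T)_μ` for every `T ∈ ℋ_R(O_N(J₀), K₀)` and every `π` commuting with `rev`, by induction on `N` through the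
Klingen and Siegel descents. [cite: Satake1963, §§6, 8–9] [cite: CartierCorvallis1979, §IV Thm. 4.1 and its proof (b)] -/
theorem coeff_satakeTransform_comp_perm_of_units_orthogonal' (hd : UnramifiedLocalConjDatum (RingHom.id K) ϖ) [Finite 𝓀[K]]
    (u : Rˣ) (hu : (u : R) ^ 2 = Nat.card 𝓀[K]) :
    ∀ (N : ℕ) (w : Multiplicative (Fin N → ℤ) →* R)
      (_hw : ∀ e : Fin N → ℤ, w (Multiplicative.ofAdd e) = ((u ^ (-(satakeTwistExp e - headSum e (N / 2))) : Rˣ) : R))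
      (T : heckeAlgebra R (unitaryGroupOfForm (RingHom.id K) ((StdForm.antidiagonal N).over K))
        (unitaryInt (RingHom.id K) ((StdForm.antidiagonal N).over K)))
      (π : Equiv.Perm (Fin N)) (_hπ : ∀ i, π (Fin.rev i) = Fin.rev (π i)) (μ : Fin N → ℤ),
      ((hd.isIwasawaExponent (N := N)).satakeTransform w T).coeff (μ ∘ π) =
        ((hd.isIwasawaExponent (N := N)).satakeTransform w T).coeff μ := by
  letI := ValuativeRel.ofValuation (Valued.v : Valuation K ℤᵐ⁰)
  haveI : (Valued.v : Valuation K ℤᵐ⁰).Compatible := Valuation.Compatible.ofValuation _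
  intro N
  induction N using Nat.strong_induction_on with
  | _ N ih =>
  match N, ih with
  | 0, _ =>
    intro w hw T π hπ μ
    rw [show π = 1 from Equiv.ext fun i => Subsingleton.elim _ _, Equiv.Perm.coe_one, Function.comp_id]
  | 1, _ =>
    intro w hw T π hπ μ
    rw [show π = 1 from Equiv.ext fun i => Subsingleton.elim _ _, Equiv.Perm.coe_one, Function.comp_id]
  | M + 2, ih =>
    intro w hw T π hπ μ
    haveI := isHeckeTriple_unitaryInt_of_finite_residueField hd.vϖ (RingHom.id K) ((StdForm.antidiagonal (M + 2)).over K)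
    /- rank `M + 2`; the induction hypothesis for `O_M(J₀)` in the weight `w'_M = u^{-(⟨ν_M, ·⟩ - hs_M)}` -/
    obtain ⟨wM, hwM⟩ := exists_weight_units_zpow_neg_satakeTwistExp_sub_headSum (N := M) (R := R) u
    have ihM := ih M (by omega) wM hwM
    -- the weight `w ∘ κ₀ = u^{-(⟨ν_M, ·⟩ + |·| - hs_M)}` of `O_M(J₀)`
    obtain ⟨w'', hw''⟩ := exists_weight_units_zpow_neg_klingen_orthogonal (M := M) (R := R) u
    have heq := comp_klingenMidHom_eq_orthogonal hw hw''
    have e1 : ∀ e : Fin M → ℤ, ((u ^ (-(satakeTwistExp e + ∑ j, e j - headSum e (M / 2))) : Rˣ) : R) =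
        ((u ^ (-∑ j, e j) : Rˣ) : R) * ((u ^ (-(satakeTwistExp e - headSum e (M / 2))) : Rˣ) : R) := fun e => by
      rw [← Units.val_mul, ← zpow_add]; congr 2; ring
    -- (i) KLINGEN: invariance under every `rev`-commuting `ρ` fixing `0`
    have stepK : ∀ (ρ : Equiv.Perm (Fin (M + 2))), (∀ i, ρ (Fin.rev i) = Fin.rev (ρ i)) → ρ 0 = 0 →
        ∀ ν : Fin (M + 2) → ℤ, ((hd.isIwasawaExponent (N := M + 2)).satakeTransform w T).coeff (ν ∘ ρ) =
          ((hd.isIwasawaExponent (N := M + 2)).satakeTransform w T).coeff ν := by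
      intro ρ hρ hρ0 ν
      obtain ⟨π', hπ', hext⟩ := exists_klingenExtend_eq hρ hρ0
      rw [← hext]
      refine hd.coeff_satakeTransform_comp_klingenExtend w π' (fun T' la => ?_) T ν
      rw [heq]
      have key := ihM T' π' hπ' la
      rw [hd.coeff_satakeTransform_eq_weight_mul, hd.coeff_satakeTransform_eq_weight_mul _ _ la, hwM, hwM] at key
      rw [hd.coeff_satakeTransform_eq_weight_mul, hd.coeff_satakeTransform_eq_weight_mul _ _ la, hw'', hw'', e1, e1,
        show (∑ j, (la ∘ ⇑π') j) = ∑ j, la j from Equiv.sum_comp π' la, mul_assoc, mul_assoc, key]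
    -- (ii) SIEGEL + KLINGEN: invariance under every `rev`-commuting `ρ` with `ρ(0)` in the first block
    obtain ⟨wU, hwU⟩ := exists_weight_units_zpow_neg_satakeTwistExp (N := M + 2) (R := R) u
    have hc : ∀ e : Fin (M + 2) → ℤ, w (Multiplicative.ofAdd e) =
        ((u ^ headSum e ((M + 2) / 2) : Rˣ) : R) * wU (Multiplicative.ofAdd e) := fun e => by
      rw [hw, hwU, ← Units.val_mul, ← zpow_add]; congr 2; ring
    have stepS : ∀ (ρ : Equiv.Perm (Fin (M + 2))), (∀ i, ρ (Fin.rev i) = Fin.rev (ρ i)) → ((ρ 0 : Fin (M + 2)) : ℕ) < (M + 2) / 2 →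
        ∀ ν : Fin (M + 2) → ℤ, ((hd.isIwasawaExponent (N := M + 2)).satakeTransform w T).coeff (ν ∘ ρ) =
          ((hd.isIwasawaExponent (N := M + 2)).satakeTransform w T).coeff ν := by
      intro ρ hρ hρ0 ν
      by_cases h0 : ((ρ 0 : Fin (M + 2)) : ℕ) = 0
      · exact stepK ρ hρ (Fin.ext h0) ν
      · -- `t = (0 k)(M+1, rev k)`, `k = ρ 0`; `t ρ` fixes `0`
        have hk0 : 0 < ((ρ 0 : Fin (M + 2)) : ℕ) := Nat.pos_of_ne_zero h0
        have htrev : ∀ i, swapPairZero (ρ 0) (Fin.rev i) = Fin.rev (swapPairZero (ρ 0) i) := swapPairZero_rev hk0 hρ0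
        have htlt : ∀ i : Fin (M + 2), ((swapPairZero (ρ 0) i : ℕ) < (M + 2) / 2 ↔ (i : ℕ) < (M + 2) / 2) :=
          swapPairZero_lt_iff hk0 hρ0
        have hfix : (swapPairZero (ρ 0) * ρ) 0 = 0 := by rw [Equiv.Perm.mul_apply, swapPairZero_apply_self hk0 hρ0]
        have h1 := stepK (swapPairZero (ρ 0) * ρ) (perm_mul_rev htrev hρ) hfix (ν ∘ ⇑(swapPairZero (ρ 0))⁻¹)
        rw [show (ν ∘ ⇑(swapPairZero (ρ 0))⁻¹) ∘ ⇑(swapPairZero (ρ 0) * ρ) = ν ∘ ρ by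
          rw [Function.comp_assoc, ← Equiv.Perm.coe_mul, ← mul_assoc, inv_mul_cancel, one_mul]] at h1
        rw [h1]
        exact hd.coeff_satakeTransform_comp_eq_of_weight_mul w wU (fun e => ((u ^ headSum e ((M + 2) / 2) : Rˣ) : R)) hc T
          (by rw [headSum_comp_perm_of_iff ν (perm_inv_lt_iff htlt)])
          (hd.coeff_satakeTransform_comp_perm_siegel u hu wU hwU T (perm_inv_rev htrev) (perm_inv_lt_iff htlt) ν)
    -- (iii) the general case: `π(0)` or `rev (π 0)` lies in the first block; `rev`-invariance through the orthogonal weight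
    obtain ⟨wO, hwO⟩ := exists_weight_units_zpow_neg_orthogonal (N := M + 2) (R := R) u
    have hOw : ∀ e : Fin (M + 2) → ℤ, (∀ i, e (Fin.rev i) = -e i) → wO (Multiplicative.ofAdd e) = w (Multiplicative.ofAdd e) :=
      fun e he => by rw [hwO, hw, orthogonalExp_eq_satakeTwistExp_sub_headSum he]
    rcases perm_zero_lt_or_rev_lt hπ with hlt | hlt
    · exact stepS π hπ hlt μ
    · have hρrev : ∀ i, ((Fin.revPerm : Equiv.Perm (Fin (M + 2))) * π) (Fin.rev i) =
          Fin.rev (((Fin.revPerm : Equiv.Perm (Fin (M + 2))) * π) i) := perm_mul_rev revPerm_rev hπ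
      have h1 := stepS ((Fin.revPerm : Equiv.Perm (Fin (M + 2))) * π) hρrev
        (by rwa [Equiv.Perm.mul_apply, Fin.revPerm_apply]) (μ ∘ Fin.rev)
      rw [show (μ ∘ Fin.rev) ∘ ⇑((Fin.revPerm : Equiv.Perm (Fin (M + 2))) * π) = μ ∘ π by
        funext i; simp only [Function.comp_apply, Equiv.Perm.mul_apply, Fin.revPerm_apply, Fin.rev_rev]] at h1
      rw [h1, ← hd.coeff_satakeTransform_eq_of_forall_rev_weight_eq wO w hOw T,
        ← hd.coeff_satakeTransform_eq_of_forall_rev_weight_eq wO w hOw T μ]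
      exact hd.coeff_satakeTransform_comp_rev_of_units_orthogonal u hu wO hwO T μ

/-- **WEYL-GROUP INVARIANCE OF THE SATAKE TRANSFORM OF THE SPLIT ORTHOGONAL GROUP `O_N(J₀)` IN EVERY RANK** (Satake; Cartier
Thm. 4.1 (b)): for a non-dyadic unramified datum for `σ = id` with finite residue field of `q` elements, every commutative ring
`R`, every unit `u` of `R` with `u² = q`, the ORTHOGONAL weight `w(e) = u^{-Λ(e)}`, `Λ(e) = ∑_{i<j, i<j'} (e_i - e_j)` (`= δ_B^{1/2}`
on cocharacters), every `T ∈ ℋ_R(O_N(J₀), K₀)`, every permutation `π` of `Fin N` commuting with `rev` and every `μ`: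
`𝒮_w(T)_{μ ∘ π} = 𝒮_w(T)_μ`. [cite: Satake1963, §§6, 8–9] [cite: CartierCorvallis1979, §IV Thm. 4.1 and its proof (b)]
[cite: Tits1979, §3.3.3] -/
theorem coeff_satakeTransform_comp_perm_of_units_orthogonal (hd : UnramifiedLocalConjDatum (RingHom.id K) ϖ) [Finite 𝓀[K]]
    (u : Rˣ) (hu : (u : R) ^ 2 = Nat.card 𝓀[K]) (N : ℕ) (w : Multiplicative (Fin N → ℤ) →* R)
    (hw : ∀ e : Fin N → ℤ, w (Multiplicative.ofAdd e) =
      ((u ^ (-∑ p ∈ (Finset.univ : Finset (Fin N × Fin N)) with (p.1 < p.2 ∧ p.1 < Fin.rev p.2), (e p.1 - e p.2)) : Rˣ) : R))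
    (T : heckeAlgebra R (unitaryGroupOfForm (RingHom.id K) ((StdForm.antidiagonal N).over K))
      (unitaryInt (RingHom.id K) ((StdForm.antidiagonal N).over K)))
    (π : Equiv.Perm (Fin N)) (hπ : ∀ i, π (Fin.rev i) = Fin.rev (π i)) (μ : Fin N → ℤ) :
    ((hd.isIwasawaExponent (N := N)).satakeTransform w T).coeff (μ ∘ π) =
      ((hd.isIwasawaExponent (N := N)).satakeTransform w T).coeff μ := by
  obtain ⟨w', hw'⟩ := exists_weight_units_zpow_neg_satakeTwistExp_sub_headSum (N := N) (R := R) u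
  have hww' : ∀ e : Fin N → ℤ, (∀ i, e (Fin.rev i) = -e i) → w (Multiplicative.ofAdd e) = w' (Multiplicative.ofAdd e) :=
    fun e he => by rw [hw, hw', orthogonalExp_eq_satakeTwistExp_sub_headSum he]
  rw [hd.coeff_satakeTransform_eq_of_forall_rev_weight_eq w w' hww' T, hd.coeff_satakeTransform_eq_of_forall_rev_weight_eq w w' hww' T μ]
  exact hd.coeff_satakeTransform_comp_perm_of_units_orthogonal' u hu N w' hw' T π hπ μ

/-- **`π^*(𝒮_w T) = 𝒮_w T`** for `O_N(J₀)`: the orthogonally normalised Satake transform is fixed by `domCongr` along `μ ↦ μ ∘ π`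
for every `π ∈ C_{S_N}(rev)`. [cite: Satake1963, §§8–9] [cite: CartierCorvallis1979, §IV Thm. 4.1] -/
theorem domCongr_funCongrLeft_satakeTransform_of_units_orthogonal (hd : UnramifiedLocalConjDatum (RingHom.id K) ϖ) [Finite 𝓀[K]]
    (u : Rˣ) (hu : (u : R) ^ 2 = Nat.card 𝓀[K]) (w : Multiplicative (Fin N → ℤ) →* R)
    (hw : ∀ e : Fin N → ℤ, w (Multiplicative.ofAdd e) =
      ((u ^ (-∑ p ∈ (Finset.univ : Finset (Fin N × Fin N)) with (p.1 < p.2 ∧ p.1 < Fin.rev p.2), (e p.1 - e p.2)) : Rˣ) : R))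
    (T : heckeAlgebra R (unitaryGroupOfForm (RingHom.id K) ((StdForm.antidiagonal N).over K))
      (unitaryInt (RingHom.id K) ((StdForm.antidiagonal N).over K)))
    {π : Equiv.Perm (Fin N)} (hπ : ∀ i, π (Fin.rev i) = Fin.rev (π i)) :
    AddMonoidAlgebra.domCongr R R (LinearEquiv.funCongrLeft ℤ ℤ π).toAddEquiv ((hd.isIwasawaExponent (N := N)).satakeTransform w T) =
      (hd.isIwasawaExponent (N := N)).satakeTransform w T := by
  refine (domCongr_eq_self_iff_coeff _ _).2 fun μ => ?_
  rw [SymmLaurent.funCongrLeft_toAddEquiv_apply]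
  exact hd.coeff_satakeTransform_comp_perm_of_units_orthogonal u hu N w hw T π hπ μ

end UnramifiedLocalConjDatum

end Main

/-! ## §4 `range 𝒮_w ⊆ R[Λ⁻]^W` for `O_N(J₀)` -/

section Image

namespace UnramifiedLocalConjDatum

/-- **`𝒮_w(T) ∈ R[Λ⁻]^W` for the split orthogonal group**: for every commutative ring `R`, `u ∈ Rˣ` with `u² = q`, the orthogonal
weight `w = u^{-Λ}` and every `T ∈ ℋ_R(O_N(J₀), K₀)`, the transform is supported on the antisymmetric cocharacters and invariant
under `W = C_{S_N}(rev)` — it lies in the tree's `unitarySatakeTarget R N = R[Λ⁻]^W`. [cite: Satake1963, §6 Thm. 7, §§8–9]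
[cite: CartierCorvallis1979, §IV Thm. 4.1] -/
theorem isIwasawaExponent_satakeTransform_mem_unitarySatakeTarget_orthogonal (hd : UnramifiedLocalConjDatum (RingHom.id K) ϖ)
    [Finite 𝓀[K]] (u : Rˣ) (hu : (u : R) ^ 2 = Nat.card 𝓀[K]) (w : Multiplicative (Fin N → ℤ) →* R)
    (hw : ∀ e : Fin N → ℤ, w (Multiplicative.ofAdd e) =
      ((u ^ (-∑ p ∈ (Finset.univ : Finset (Fin N × Fin N)) with (p.1 < p.2 ∧ p.1 < Fin.rev p.2), (e p.1 - e p.2)) : Rˣ) : R))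
    (T : heckeAlgebra R (unitaryGroupOfForm (RingHom.id K) ((StdForm.antidiagonal N).over K))
      (unitaryInt (RingHom.id K) ((StdForm.antidiagonal N).over K))) :
    (hd.isIwasawaExponent (N := N)).satakeTransform w T ∈ unitarySatakeTarget R N :=
  (mem_unitarySatakeTarget_iff _).2 ⟨fun _ hμ => hd.coeff_satakeTransform_eq_zero_of_not_rev w T hμ,
    fun π hπ μ => hd.coeff_satakeTransform_comp_perm_of_units_orthogonal u hu N w hw T π hπ μ⟩

end UnramifiedLocalConjDatum

end Image

end Literature.NumberTheory.Automorphic.HermitianLattice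

end
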